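import Summits.CriticalPhenomena.PercolationContinuityZ3.Theorems.PercNearOneGluingNoHeavyLowerTailSharpTCSReduction
import HarnessLib

/-!
# `NoHeavyLowerTail` (stmt-CriticalPhenomena-4575) — the FRAGMENTED DECOMPOSITION of STCS2: two transfer inequalities (C4, C8)
# that imply the sharpened guarded Cauchy–Schwarz law at every level (typed reduction)

Support file (lemma factory #8 `prim-lf-8`, gen 5, batch 7; `--supports stmt-CriticalPhenomena-4575`).  No definitions, no named facts,
no sorries.  `μ = prodBernoulli w` on `Fin n`, relays `A`, observer `o`, level `j`, `N = |π(o)|`, `R_a = {|π(a)| ≤ j}`, `S(a) = μ(R_a)`,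
`F = {o ↮ c}`, `L = {1 ≤ N ≤ j}`, and the FRAGMENTED WORLD `M = {every relay is light} = ⋂_a R_a`, `m = μ(M)`.  Pieces:

  `P₁ = μ(F ∩ L ∩ M)`,  `P₂ = μ((F ∩ L ∩ R_c) ∖ M)`,  `P₃ = μ(L ∖ R_c)`,  `g' = μ(F ∩ {j < N} ∩ R_c)`,  `u_c = S(c) − m`,  `τ = t − m`.

Then `μ(F ∩ L) = P₁ + P₂ + P₃`, `μ(F ∩ {1 ≤ N} ∩ R_c) = P₁ + P₂ + g'`, and STCS2(c,t) (`μ(F ∩ L)·S(c) ≤ μ(F ∩ {1≤N} ∩ R_c)·t`, the binder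
of `Theorems.noHeavyLowerTail_of_sharpTCS`) is EQUIVALENT to `(P₁ + P₂)(u_c − τ) + P₃ (m + u_c) ≤ g' (m + τ)`, hence follows from the pair

* **C4** (fragmented transfer):  `P₁·(u_c − τ) + P₃·m ≤ g'·m`,
* **C8** (heavy-world packing):  `P₂·(u_c − τ) + P₃·u_c ≤ g'·τ`.

At the top level `j = |A| − 2` both are theorems (`…TwoLevelPackingCardSubTwo*`: C8 is the packing chain, C4 follows from the fragmented-world
transfer and the chain), which is how STCS2/QP/QG were proved there for every `|A|`.  For general cells they are CANDIDATES: 0 violations in the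
seat's exact screens (1 416 champion cases in the upper-half cells (4,2)…(8,5), 471 in the lower-half cells (6,2),(7,1),(7,2),(8,2),(8,3);
run/shared/lean/prim/prim-lf-8/CANDIDATES.md v7 B7-9; ttrl2 request `lf8-b7-upperhalf-C4C8`).

* `FragmentedDecomposition.sharpTCS_of_pieces` — one instance: C4 ∧ C8 ⇒ STCS2(c, t) (pure decomposition + algebra, every `j`, every `c ∈ A`);
* `noHeavyLowerTail_of_fragmentedDecomposition` — C4 ∧ C8 at all champions ⇒ `NoHeavyLowerTail`.
-/

noncomputable section

namespace Summit.CriticalPhenomena.PercolationContinuityZ3.Theorems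

open MeasureTheory Set Literature.Probability.LatticeModels Literature.Probability.Percolation
open scoped Classical BigOperators

variable {n : ℕ}

namespace FragmentedDecomposition

/-- **C4 ∧ C8 ⇒ STCS2 at one instance** (every level `j`, every `c ∈ A`, every real `t`). [this work] -/
theorem sharpTCS_of_pieces (w : Sym2 (Fin n) → unitInterval) (A : Finset (Fin n)) (o c : Fin n) (j : ℕ) (t : ℝ)
    (hc : c ∈ A)
    (hC4 :
      (prodBernoulli w).real ((openConn o c : Set (BondConfig (Fin n)))ᶜ ∩
            {ω | 1 ≤ (A.filter fun x => ω ∈ openConn o x).card ∧ (A.filter fun x => ω ∈ openConn o x).card ≤ j} ∩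
            {ω | ∀ a ∈ A, (A.filter fun x => ω ∈ openConn a x).card ≤ j}) *
          (((prodBernoulli w).real {ω : BondConfig (Fin n) | (A.filter fun x => ω ∈ openConn c x).card ≤ j} -
              (prodBernoulli w).real {ω : BondConfig (Fin n) | ∀ a ∈ A, (A.filter fun x => ω ∈ openConn a x).card ≤ j}) -
            (t - (prodBernoulli w).real {ω : BondConfig (Fin n) | ∀ a ∈ A, (A.filter fun x => ω ∈ openConn a x).card ≤ j})) +
        (prodBernoulli w).real ({ω : BondConfig (Fin n) |
              1 ≤ (A.filter fun x => ω ∈ openConn o x).card ∧ (A.filter fun x => ω ∈ openConn o x).card ≤ j} \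
            {ω | (A.filter fun x => ω ∈ openConn c x).card ≤ j}) *
          (prodBernoulli w).real {ω : BondConfig (Fin n) | ∀ a ∈ A, (A.filter fun x => ω ∈ openConn a x).card ≤ j} ≤
      (prodBernoulli w).real ((openConn o c : Set (BondConfig (Fin n)))ᶜ ∩
            {ω | j < (A.filter fun x => ω ∈ openConn o x).card} ∩
            {ω | (A.filter fun x => ω ∈ openConn c x).card ≤ j}) *
          (prodBernoulli w).real {ω : BondConfig (Fin n) | ∀ a ∈ A, (A.filter fun x => ω ∈ openConn a x).card ≤ j})
    (hC8 :
      (prodBernoulli w).real (((openConn o c : Set (BondConfig (Fin n)))ᶜ ∩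
            {ω | 1 ≤ (A.filter fun x => ω ∈ openConn o x).card ∧ (A.filter fun x => ω ∈ openConn o x).card ≤ j} ∩
            {ω | (A.filter fun x => ω ∈ openConn c x).card ≤ j}) \
            {ω | ∀ a ∈ A, (A.filter fun x => ω ∈ openConn a x).card ≤ j}) *
          (((prodBernoulli w).real {ω : BondConfig (Fin n) | (A.filter fun x => ω ∈ openConn c x).card ≤ j} -
              (prodBernoulli w).real {ω : BondConfig (Fin n) | ∀ a ∈ A, (A.filter fun x => ω ∈ openConn a x).card ≤ j}) -
            (t - (prodBernoulli w).real {ω : BondConfig (Fin n) | ∀ a ∈ A, (A.filter fun x => ω ∈ openConn a x).card ≤ j})) +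
        (prodBernoulli w).real ({ω : BondConfig (Fin n) |
              1 ≤ (A.filter fun x => ω ∈ openConn o x).card ∧ (A.filter fun x => ω ∈ openConn o x).card ≤ j} \
            {ω | (A.filter fun x => ω ∈ openConn c x).card ≤ j}) *
          ((prodBernoulli w).real {ω : BondConfig (Fin n) | (A.filter fun x => ω ∈ openConn c x).card ≤ j} -
            (prodBernoulli w).real {ω : BondConfig (Fin n) | ∀ a ∈ A, (A.filter fun x => ω ∈ openConn a x).card ≤ j}) ≤
      (prodBernoulli w).real ((openConn o c : Set (BondConfig (Fin n)))ᶜ ∩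
            {ω | j < (A.filter fun x => ω ∈ openConn o x).card} ∩
            {ω | (A.filter fun x => ω ∈ openConn c x).card ≤ j}) *
          (t - (prodBernoulli w).real {ω : BondConfig (Fin n) | ∀ a ∈ A, (A.filter fun x => ω ∈ openConn a x).card ≤ j})) :
    (prodBernoulli w).real ((openConn o c : Set (BondConfig (Fin n)))ᶜ ∩
          {ω | 1 ≤ (A.filter fun x => ω ∈ openConn o x).card ∧
            (A.filter fun x => ω ∈ openConn o x).card ≤ j}) *
        (prodBernoulli w).real {ω : BondConfig (Fin n) | (A.filter fun x => ω ∈ openConn c x).card ≤ j} ≤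
      (prodBernoulli w).real ((openConn o c : Set (BondConfig (Fin n)))ᶜ ∩
          {ω | 1 ≤ (A.filter fun x => ω ∈ openConn o x).card ∧
            (A.filter fun x => ω ∈ openConn c x).card ≤ j}) * t := by
  set μ := prodBernoulli w with hμ
  set F : Set (BondConfig (Fin n)) := (openConn o c : Set (BondConfig (Fin n)))ᶜ with hF
  set L : Set (BondConfig (Fin n)) := {ω | 1 ≤ (A.filter fun x => ω ∈ openConn o x).card ∧
    (A.filter fun x => ω ∈ openConn o x).card ≤ j} with hL
  set Rc : Set (BondConfig (Fin n)) := {ω | (A.filter fun x => ω ∈ openConn c x).card ≤ j} with hRc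
  set M : Set (BondConfig (Fin n)) := {ω | ∀ a ∈ A, (A.filter fun x => ω ∈ openConn a x).card ≤ j} with hM
  set Gd : Set (BondConfig (Fin n)) := {ω | j < (A.filter fun x => ω ∈ openConn o x).card} with hGd
  set V : Set (BondConfig (Fin n)) := {ω | 1 ≤ (A.filter fun x => ω ∈ openConn o x).card ∧
    (A.filter fun x => ω ∈ openConn c x).card ≤ j} with hV
  have hmeas : ∀ s : Set (BondConfig (Fin n)), MeasurableSet s := fun _ => MeasurableSet.of_discrete
  -- on `{o ↔ c}` the observer's block is the champion's block
  have hblock : ∀ ω : BondConfig (Fin n), ω ∈ (openConn o c : Set (BondConfig (Fin n))) →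
      (A.filter fun x => ω ∈ openConn o x) = (A.filter fun x => ω ∈ openConn c x) :=
    fun ω h => (GuardedCIL.filter_eq_of_reachable A h).symm
  have hMR : M ⊆ Rc := fun ω hω => hω c hc
  -- (i) `F ∩ L = (F ∩ L ∩ M) ⊔ ((F ∩ L ∩ R_c) ∖ M) ⊔ (L ∖ R_c)`
  have hLsplit : μ.real (F ∩ L) = μ.real (F ∩ L ∩ M) + μ.real ((F ∩ L ∩ Rc) \ M) + μ.real (L \ Rc) := by
    have h1 : μ.real (F ∩ L) = μ.real (F ∩ L ∩ Rc) + μ.real ((F ∩ L) \ Rc) :=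
      (measureReal_inter_add_sdiff (μ := μ) (s := F ∩ L) (t := Rc) (hmeas _)).symm
    have h2 : μ.real (F ∩ L ∩ Rc) = μ.real (F ∩ L ∩ Rc ∩ M) + μ.real ((F ∩ L ∩ Rc) \ M) :=
      (measureReal_inter_add_sdiff (μ := μ) (s := F ∩ L ∩ Rc) (t := M) (hmeas _)).symm
    have h3 : F ∩ L ∩ Rc ∩ M = F ∩ L ∩ M := by
      ext ω; simp only [mem_inter_iff]
      exact ⟨fun h => ⟨⟨h.1.1.1, h.1.1.2⟩, h.2⟩, fun h => ⟨⟨⟨h.1.1, h.1.2⟩, hMR h.2⟩, h.2⟩⟩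
    have h4 : (F ∩ L) \ Rc = L \ Rc := by
      ext ω; simp only [mem_sdiff, mem_inter_iff]
      constructor
      · rintro ⟨⟨-, hl⟩, hr⟩; exact ⟨hl, hr⟩
      · rintro ⟨hl, hr⟩
        refine ⟨⟨fun hoc => hr ?_, hl⟩, hr⟩
        show (A.filter fun x => ω ∈ openConn c x).card ≤ j
        rw [← hblock ω hoc]; exact hl.2
    rw [h1, h2, h3, h4]
  -- (ii) `F ∩ {1 ≤ N} ∩ R_c = (F ∩ L ∩ M) ⊔ ((F ∩ L ∩ R_c) ∖ M) ⊔ (F ∩ {j < N} ∩ R_c)`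
  have hVsplit : μ.real (F ∩ V) = μ.real (F ∩ L ∩ M) + μ.real ((F ∩ L ∩ Rc) \ M) + μ.real (F ∩ Gd ∩ Rc) := by
    have h1 : μ.real (F ∩ V) = μ.real (F ∩ V ∩ L) + μ.real ((F ∩ V) \ L) :=
      (measureReal_inter_add_sdiff (μ := μ) (s := F ∩ V) (t := L) (hmeas _)).symm
    have h2 : F ∩ V ∩ L = F ∩ L ∩ Rc := by
      ext ω; simp only [mem_inter_iff, hV, hL, hRc, mem_setOf_eq]; tauto
    have h3 : (F ∩ V) \ L = F ∩ Gd ∩ Rc := by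
      ext ω; simp only [mem_sdiff, mem_inter_iff, hV, hL, hRc, hGd, mem_setOf_eq, not_and, not_le]
      constructor
      · rintro ⟨⟨hf, h1, hr⟩, hnl⟩; exact ⟨⟨hf, hnl h1⟩, hr⟩
      · rintro ⟨⟨hf, hg⟩, hr⟩; exact ⟨⟨hf, by omega, hr⟩, fun _ => hg⟩
    have h4 : μ.real (F ∩ L ∩ Rc) = μ.real (F ∩ L ∩ Rc ∩ M) + μ.real ((F ∩ L ∩ Rc) \ M) :=
      (measureReal_inter_add_sdiff (μ := μ) (s := F ∩ L ∩ Rc) (t := M) (hmeas _)).symm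
    have h5 : F ∩ L ∩ Rc ∩ M = F ∩ L ∩ M := by
      ext ω; simp only [mem_inter_iff]
      exact ⟨fun h => ⟨⟨h.1.1.1, h.1.1.2⟩, h.2⟩, fun h => ⟨⟨⟨h.1.1, h.1.2⟩, hMR h.2⟩, h.2⟩⟩
    rw [h1, h2, h3, h4, h5]
  -- (iii) algebra
  rw [hLsplit, hVsplit]
  nlinarith [hC4, hC8]

end FragmentedDecomposition

open FragmentedDecomposition in
/-- **The fragmented decomposition closes the crux.**  If for every weighted graph on `Fin n`, relays `A`, observer `o ∉ A`,
relay `c ∈ A`, level `j` and admissible `t` (`0 ≤ t`, `S(a) ≤ t ≤ S(c)` for `a ≠ c`) the two transfer inequalities C4 and C8 hold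
(hypotheses `hC4`, `hC8` of `sharpTCS_of_pieces`), then `NoHeavyLowerTail` (C4 ∧ C8 ⇒ STCS2 ⇒ QP ⇒ QG ⇒ CIL ⇒ crux). [this work] -/
theorem noHeavyLowerTail_of_fragmentedDecomposition
    (hC : ∀ (n : ℕ) (w : Sym2 (Fin n) → unitInterval) (A : Finset (Fin n)) (o c : Fin n) (j : ℕ) (t : ℝ),
      o ∉ A → c ∈ A → 0 ≤ t →
      (∀ a ∈ A, a ≠ c →
        (prodBernoulli w).real {ω : BondConfig (Fin n) | (A.filter fun x => ω ∈ openConn a x).card ≤ j} ≤ t) →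
      t ≤ (prodBernoulli w).real {ω : BondConfig (Fin n) | (A.filter fun x => ω ∈ openConn c x).card ≤ j} →
      ((prodBernoulli w).real ((openConn o c : Set (BondConfig (Fin n)))ᶜ ∩
            {ω | 1 ≤ (A.filter fun x => ω ∈ openConn o x).card ∧ (A.filter fun x => ω ∈ openConn o x).card ≤ j} ∩
            {ω | ∀ a ∈ A, (A.filter fun x => ω ∈ openConn a x).card ≤ j}) *
          (((prodBernoulli w).real {ω : BondConfig (Fin n) | (A.filter fun x => ω ∈ openConn c x).card ≤ j} -
              (prodBernoulli w).real {ω : BondConfig (Fin n) | ∀ a ∈ A, (A.filter fun x => ω ∈ openConn a x).card ≤ j}) -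
            (t - (prodBernoulli w).real {ω : BondConfig (Fin n) | ∀ a ∈ A, (A.filter fun x => ω ∈ openConn a x).card ≤ j})) +
        (prodBernoulli w).real ({ω : BondConfig (Fin n) |
              1 ≤ (A.filter fun x => ω ∈ openConn o x).card ∧ (A.filter fun x => ω ∈ openConn o x).card ≤ j} \
            {ω | (A.filter fun x => ω ∈ openConn c x).card ≤ j}) *
          (prodBernoulli w).real {ω : BondConfig (Fin n) | ∀ a ∈ A, (A.filter fun x => ω ∈ openConn a x).card ≤ j} ≤
      (prodBernoulli w).real ((openConn o c : Set (BondConfig (Fin n)))ᶜ ∩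
            {ω | j < (A.filter fun x => ω ∈ openConn o x).card} ∩
            {ω | (A.filter fun x => ω ∈ openConn c x).card ≤ j}) *
          (prodBernoulli w).real {ω : BondConfig (Fin n) | ∀ a ∈ A, (A.filter fun x => ω ∈ openConn a x).card ≤ j}) ∧
      ((prodBernoulli w).real (((openConn o c : Set (BondConfig (Fin n)))ᶜ ∩
            {ω | 1 ≤ (A.filter fun x => ω ∈ openConn o x).card ∧ (A.filter fun x => ω ∈ openConn o x).card ≤ j} ∩
            {ω | (A.filter fun x => ω ∈ openConn c x).card ≤ j}) \
            {ω | ∀ a ∈ A, (A.filter fun x => ω ∈ openConn a x).card ≤ j}) *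
          (((prodBernoulli w).real {ω : BondConfig (Fin n) | (A.filter fun x => ω ∈ openConn c x).card ≤ j} -
              (prodBernoulli w).real {ω : BondConfig (Fin n) | ∀ a ∈ A, (A.filter fun x => ω ∈ openConn a x).card ≤ j}) -
            (t - (prodBernoulli w).real {ω : BondConfig (Fin n) | ∀ a ∈ A, (A.filter fun x => ω ∈ openConn a x).card ≤ j})) +
        (prodBernoulli w).real ({ω : BondConfig (Fin n) |
              1 ≤ (A.filter fun x => ω ∈ openConn o x).card ∧ (A.filter fun x => ω ∈ openConn o x).card ≤ j} \
            {ω | (A.filter fun x => ω ∈ openConn c x).card ≤ j}) *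
          ((prodBernoulli w).real {ω : BondConfig (Fin n) | (A.filter fun x => ω ∈ openConn c x).card ≤ j} -
            (prodBernoulli w).real {ω : BondConfig (Fin n) | ∀ a ∈ A, (A.filter fun x => ω ∈ openConn a x).card ≤ j}) ≤
      (prodBernoulli w).real ((openConn o c : Set (BondConfig (Fin n)))ᶜ ∩
            {ω | j < (A.filter fun x => ω ∈ openConn o x).card} ∩
            {ω | (A.filter fun x => ω ∈ openConn c x).card ≤ j}) *
          (t - (prodBernoulli w).real {ω : BondConfig (Fin n) | ∀ a ∈ A, (A.filter fun x => ω ∈ openConn a x).card ≤ j}))) :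
    Summit.CriticalPhenomena.PercolationContinuityZ3.Theses.PercNearOneGluing.NoHeavyLowerTail :=
  noHeavyLowerTail_of_sharpTCS fun n w A o c j t ho hc ht hdom htc =>
    sharpTCS_of_pieces w A o c j t hc (hC n w A o c j t ho hc ht hdom htc).1 (hC n w A o c j t ho hc ht hdom htc).2

end Summit.CriticalPhenomena.PercolationContinuityZ3.Theorems

end
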